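import Literature.Barriers.FinalStateConjecture.TrappingDerivativeLossBeams
import Literature.Geometry.Lorentzian.KerrPhotonOrbit
import HarnessLib

/-!
# Sbierski's Kerr trapping theorem: Gaussian beams along a *given* null geodesic, and the beam
# input reduced to it and to the trapped geodesic of §7A
(fourth companion file of `Literature/Barriers/FinalStateConjecture/TrappingDerivativeLoss.lean`;
family `gr`, summit `FinalStateConjecture`; namespace `Literature.Barriers.FinalStateConjecture`)

`TrappingDerivativeLossBeams.lean` reduces the beam input of Sbierski's Thm. 5.1/7.4 on Kerr to
the named fact `SbierskiKerrTrappedGeodesicBeams`: Gaussian beams *along the trapped null geodesic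
of §7A*, the geodesic being hidden in the energy profile `e(τ) = −g(N, γ̇)|_{Im γ ∩ Σ_τ}` of that
fact. This file separates the two ingredients the source keeps apart:

* `KerrNullGeodesicGaussianBeams` (**named fact**) — the theory of Part I of the paper (§3: the
  Gaussian beams of the closing definition with the three conditions of the proof of Thm. 2.1 via
  its second lemma; §4: the geometric characterisation of their energy, with the third remark
  following the theorem for real-valued beams), **along an arbitrary future-directed null geodesic
  `γ` of the Kerr exterior**, `0 < M`, `0 ≤ a ≤ M`, rendered on the ingoing Kerr–Schild chart with
  `t = t*`, `Σ_τ = {t* = τ}`, `N = −(dt*)♯`: for every open `𝒩 ⊇ γ([0, ∞))`, every `T > 0`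
  attained by `t* ∘ γ` on `[0, ∞)` and every `μ > 0` there are an open `𝒩₀`,
  `γ([0, ∞)) ⊆ 𝒩₀ ⊆ 𝒩`, and a `C^∞` function `u` on the chart vanishing off `𝒩₀` with
  `‖□_g u‖²_{L²(R_{[0,T]})} ≤ μ`, `E^N_0(u) = −g(N, γ̇(0)) = γ̇⁰(0)` and
  `|E^N_τ(u) − γ̇⁰(s)| < μ` whenever `0 ≤ τ ≤ T`, `0 ≤ s`, `t*(γ(s)) = τ`. The geodesic enters
  exactly as in Thm. 5.1 (arXiv Thm. 8: solutions in the Gaussian-beam limit along an arbitrary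
  null geodesic, i.e. beams *and* the Cauchy problem), of which the present fact is the
  approximate-solution half; `E^N_τ = Kerr.leafFlux M a 0 · τ` and
  `‖·‖²_{L²(R_{[0,T]})} = slabSqNorm` as in the previous files (`−g(N, γ̇) = γ̇⁰`:
  `Kerr.bilin_timeVector`).
* `SbierskiKerrTrappedGeodesicBeams.of_nullGeodesicBeams` (**proved**) — the beam input of the
  previous file from `KerrNullGeodesicGaussianBeams` and the trapped null geodesic of §7A in the
  form vendored by `KerrGaussianBeams.lean` (`Sbierski2015_kerr_trappedNullGeodesic`: a null
  geodesic `γ` of the exterior on `{r = r₀}`, `r₀ > r₊`, with `e₁ ≤ γ̇⁰ ≤ e₂`, `0 < e₁`, `t* ∘ γ`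
  continuous, strictly increasing, onto `[0, ∞)`; proved from the explicit retrograde equatorial
  photon orbit in `KerrPhotonOrbit.lean`, `Sbierski2015_kerr_trappedNullGeodesic_holds`): take
  the cylinder
  `𝒩 = {r > r₊ + δ} ∩ {‖y‖ < R}`, `δ = (r₀ − r₊)/2`, `R ≥ R₀ = r₀ + |a| + 1` (an orbit on
  `{r = r₀}` has `‖y‖ ≤ r₀ + |a|`, `Kerr.spatialNorm_le_of_radius_eq`), the energy profile
  `e(τ) = γ̇⁰(s_τ)` with `s_τ ≥ 0` the parameter at which `γ` crosses `Σ_τ` (intermediate value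
  theorem), and the beam for `(𝒩, T + 1, μ)`.

Consequently `SbierskiKerrTrappedGeodesicBeams` follows from `KerrNullGeodesicGaussianBeams`
alone (`…of_nullGeodesicBeams'`, the geodesic being the tree's theorem), and
`SbierskiKerrLocalisedSolutions`, `SbierskiTrappingObstruction` and `SbierskiKerrTrappingLED`
follow from (A) `KerrWaveCauchyEnergyEstimate` and `KerrNullGeodesicGaussianBeams`
(`…of_cauchy_of_nullGeodesicBeams`): the trust base of the barrier along this path is
{(A), `KerrNullGeodesicGaussianBeams`} — the Cauchy problem with the energy estimate, and the
Gaussian-beam theory of Part I along a given null geodesic.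

## Rendering (as in `KerrGaussianBeams.lean`, all on the side of a WEAKER vendored statement)

* The setting of Part I is a time-oriented globally hyperbolic `(M, g)` with time function `t`,
  `Σ_τ = {t = τ}` (Def. of §3, Thm. of §4); as in §6A/§7A of the paper it is taken to be
  `M = D(Σ₀)` in the domain of outer communications with `t = t*`, equivalently the surgered
  Kerr–Schild background of `KerrSchildWaveCauchyProblem.lean` (`ℝ⁴` with `η + φ ℓ ⊗ ℓ`, equal to
  `g_{M,a}` on `{r ≥ r₊}`, globally hyperbolic with Cauchy leaves `{t* = τ}`), in which the
  exterior embeds isometrically; beams supported in `𝒩₀ ⊆ {r > r₊}` restrict to the chart.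
* `γ` is quantified on all of `ℝ` (the source: `γ : [0, S) → M`), null and future-directed
  (`γ̇⁰ > 0`, i.e. `g(N, γ̇) < 0`) everywhere, with `t* ∘ γ` strictly increasing (so that
  `Im γ|_{[0,∞)} ∩ Σ_τ` is the single point `γ(s_τ)`); stronger hypotheses, weaker fact.
* For the common choice of `λ`: §4's theorem gives `𝒩₀ ⊆ 𝒩` and `λ₀` such that *every* beam
  `ũ_{λ,𝒩₀}`, `λ ≥ λ₀`, with initial `N`-energy `−g(N, γ̇(0))` obeys the energy inequality, while
  `‖□ũ_{λ,𝒩₀}‖_{L²(R_{[0,T]})} → 0` (`λ → ∞`) by §3's second lemma and the normalisation of the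
  proof of Thm. 2.1; a `λ ≥ λ₀` with `‖□ũ_λ‖² ≤ μ` is taken, and the real part (third remark after
  §4's theorem; second remark after Thm. 2.1).
* `|E − e| < μ` for `E ∈ [0, ∞]` is rendered `E ≠ ∞ ∧ |E.toReal − e| < μ`.

## References

* J. Sbierski, *Characterisation of the energy of Gaussian beams on Lorentzian manifolds: with
  applications to black hole spacetimes*, Anal. PDE 8 (2015) 1379–1420 (arXiv:1311.2477): §2,
  proof of Thm. 2.1 (three conditions, normalisation `ũ_λ = u_λ/√(E^N_0(u_λ))`) with the second
  remark after it [arXiv Thm. 1, Remark 3]; §3, second lemma and closing definition [arXiv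
  Lemma 5, Def. 6]; §4, theorem and third remark [arXiv Thm. 7]; Thm. 5.1 [arXiv Thm. 8]; §7A
  [arXiv §3.2.1, pp. 26–27]. Bracketed numbers are those of the held arXiv text.
* The tree's `Literature/Geometry/Lorentzian/KerrGaussianBeams.lean` (the fact
  `Sbierski2015_kerr_trappedNullGeodesic` and the rendering conventions shared here) and
  `KerrPhotonOrbit.lean`
  (`Sbierski2015_kerr_trappedNullGeodesic_holds`, the retrograde equatorial circular photon
  orbit; Bardeen–Press–Teukolsky 1972, (2.18)).
-/

noncomputable section

open Set Filter Topology MeasureTheory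
open scoped Manifold ContDiff ENNReal

namespace Literature.Barriers.FinalStateConjecture

open Literature.Geometry.Lorentzian

/-! ### Gaussian beams along a given null geodesic of the Kerr exterior (named fact) -/

/-- **Gaussian beams along a given null geodesic of the Kerr exterior, with the geometric
characterisation of their energy** (named fact; Part I of Sbierski, Anal. PDE 8 (2015), rendered
on Kerr). Printed ingredients. (§3, closing definition [arXiv Def. 6]) On a time-oriented
globally hyperbolic `(M, g)` with time function `t`, `Σ_τ = {t = τ}`, for
`γ : [0, S) → M` "an affinely parametrised future directed null geodesic with `γ(0) ∈ Σ₀`" and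
`N` timelike future directed, the Gaussian beams `u_{λ,𝒩} = a_𝒩 e^{iλφ}`, `a_𝒩 = a · χ_𝒩`,
`supp χ_𝒩 ⊆ 𝒩`, and `ũ_{λ,𝒩} = u_{λ,𝒩} √E / √(E^N_0(u_{λ,𝒩}))`, "a Gaussian beam along `γ` […]
with initial `N`-energy `E`"; (§3, second lemma [arXiv Lemma 5], with the proof of Thm. 2.1)
`‖□u_λ‖_{L²(R_{[0,T]})} ≤ C(T)`, `E^N_0(u_λ) → ∞`, `u_λ` supported in `𝒩`, whence
`‖□ũ_λ‖_{L²(R_{[0,T]})} → 0` for `λ → ∞`; (§4, theorem [arXiv Thm. 7]) "For any `T > 0` with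
`Im(γ) ∩ Σ_T ≠ ∅` and for any `μ > 0` there exists a neighbourhood `𝒩₀` of `γ` and a `λ₀ > 0`
such that any Gaussian beam `ũ_{λ,𝒩}` along `γ` […] with parameters `λ ≥ λ₀` and `𝒩₀`, and with
initial `N`-energy equal to `−g(N, γ̇)|_{γ(0)}` satisfies
`|E^N_τ(ũ_{λ,𝒩₀}) − [−g(N, γ̇)|_{Im(γ) ∩ Σ_τ}]| < μ` for all `0 ≤ τ ≤ T`", where (its proof)
`𝒩₀ ⊆ 𝒩` for any prescribed neighbourhood `𝒩` of `γ`, and (third remark) "by taking the real or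
the imaginary part, one can also define a real valued Gaussian beam. The result […] also holds
true in this case". **Vendored form** (module docstring, "Rendering": `(M, g, t, N)` = the
exterior of Kerr, `0 < M`, `0 ≤ a ≤ M`, inside `D(Σ₀)`/the surgered Kerr–Schild background, with
`t*`, `Σ_τ = {t* = τ}`, `N = −(dt*)♯`, so `−g(N, γ̇) = γ̇⁰`; `E^N_τ = Kerr.leafFlux M a 0 · τ`,
`‖□·‖²_{L²(R_{[0,T]})} = slabSqNorm`; one `λ ≥ λ₀` with `‖□ũ_λ‖² ≤ μ` chosen; real part taken):
for every geodesic `γ : ℝ → Kerr.exterior M a` of the Levi-Civita connection of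
`Kerr.smoothMetric M a r₊` with null velocity, `γ̇⁰ > 0`, `t*(γ 0) = 0` and `t* ∘ γ` strictly
increasing, every open `𝒩 ⊇ γ([0, ∞))`, every `T > 0` with `t*(γ s) = T` for some `s ≥ 0` and
every `μ > 0`, there are an open `𝒩₀` with `γ([0, ∞)) ⊆ 𝒩₀ ⊆ 𝒩` and `u : Kerr.exterior M a → ℝ`,
`C^∞` on the chart and vanishing off `𝒩₀`, with `slabSqNorm (□_g u) T ≤ μ`,
`E^N_0(u) = γ̇⁰(0)`, and `E^N_τ(u)` finite with `|E^N_τ(u) − γ̇⁰(s)| < μ` whenever `0 ≤ τ ≤ T`,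
`0 ≤ s`, `t*(γ s) = τ`. Not provable from Mathlib/Literature at present (no geometric optics:
Jacobi/Riccati systems along `γ`, Borel's lemma, the Gaussian-integral asymptotics of §4).
[cite: Sbierski2015, §4 (theorem; third remark) with §3 (second lemma; closing def.) and §2 (proof of Thm. 2.1)] -/
def KerrNullGeodesicGaussianBeams : Prop :=
  ∀ [Kerr.Facts] [Kerr.SliceFacts] (M a : ℝ), 0 < M → 0 ≤ a → a ≤ M →
    ∀ γ : ℝ → Kerr.exterior M a,
      IsGeodesic (Kerr.smoothMetric M a (Kerr.rPlus M a)).leviCivita γ →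
      (∀ s, (Kerr.smoothMetric M a (Kerr.rPlus M a)).IsNull (velocity 𝓘(ℝ, E4) γ s)) →
      (∀ s, 0 < E4.time (velocity 𝓘(ℝ, E4) γ s)) →
      (γ 0 : E4) 0 = 0 →
      StrictMono (fun s ↦ (γ s : E4) 0) →
      ∀ 𝒩 : Set (Kerr.exterior M a), IsOpen 𝒩 → γ '' Ici 0 ⊆ 𝒩 →
      ∀ T : ℝ, 0 < T → (∃ s, 0 ≤ s ∧ (γ s : E4) 0 = T) →
      ∀ μ : ℝ, 0 < μ →
        ∃ 𝒩₀ : Set (Kerr.exterior M a), IsOpen 𝒩₀ ∧ γ '' Ici 0 ⊆ 𝒩₀ ∧ 𝒩₀ ⊆ 𝒩 ∧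
        ∃ u : Kerr.exterior M a → ℝ,
          ContMDiff 𝓘(ℝ, E4) 𝓘(ℝ, ℝ) ∞ u ∧
          (∀ x : Kerr.exterior M a, x ∉ 𝒩₀ → u x = 0) ∧
          slabSqNorm (Kerr.exterior M a) (fun x ↦
              (Kerr.smoothMetric M a (Kerr.rPlus M a)).toPseudoRiemannianMetric.dalembertian u x)
            T ≤ ENNReal.ofReal μ ∧
          Kerr.leafFlux M a 0 u 0 = ENNReal.ofReal (E4.time (velocity 𝓘(ℝ, E4) γ 0)) ∧
          ∀ τ : ℝ, 0 ≤ τ → τ ≤ T → ∀ s : ℝ, 0 ≤ s → (γ s : E4) 0 = τ →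
            Kerr.leafFlux M a 0 u τ ≠ ⊤ ∧
            |(Kerr.leafFlux M a 0 u τ).toReal - E4.time (velocity 𝓘(ℝ, E4) γ s)| < μ

/-! ### Crossing parameters of a future-directed curve with the leaves `Σ_τ` -/

/-- **A curve starting on `Σ₀` whose `t*`-coordinate is continuous and unbounded above crosses
every leaf `Σ_τ`, `τ ≥ 0`, at a nonnegative parameter** (intermediate value theorem). [folklore] -/
theorem exists_param_of_time {X : Type*} (f : ℝ → X) (t : X → ℝ) (h0 : t (f 0) = 0)
    (hc : Continuous fun s ↦ t (f s)) (hlim : Tendsto (fun s ↦ t (f s)) atTop atTop)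
    {τ : ℝ} (hτ : 0 ≤ τ) : ∃ s, 0 ≤ s ∧ t (f s) = τ := by
  obtain ⟨S, hS⟩ := (Filter.tendsto_atTop_atTop.mp hlim) τ
  set s₁ := max S 0 with hs₁
  have hs₁τ : τ ≤ t (f s₁) := hS s₁ (le_max_left _ _)
  have hmem : τ ∈ Set.Icc (t (f 0)) (t (f s₁)) := ⟨by rw [h0]; exact hτ, hs₁τ⟩
  obtain ⟨s, hs, hst⟩ := intermediate_value_Icc (le_max_right S 0) hc.continuousOn hmem
  exact ⟨s, hs.1, hst⟩

/-! ### The beam input from the §7A geodesic and the beams along a given geodesic -/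

/-- **The beam input of `TrappingDerivativeLossBeams.lean` from the trapped null geodesic of
§7A and the Gaussian beams along a given null geodesic.** Given the geodesic `γ` on `{r = r₀}`,
`r₀ > r₊`, with `0 < e₁ ≤ γ̇⁰ ≤ e₂` and `t* ∘ γ` continuous, strictly increasing, unbounded
(`Sbierski2015_kerr_trappedNullGeodesic`), put `R₀ := r₀ + |a| + 1` (`‖γ(s)⃗‖ ≤ r₀ + |a|`,
`Kerr.spatialNorm_le_of_radius_eq`), and for `R ≥ R₀`: `δ := (r₀ − r₊)/2`, `c₁ := e₁`,
`C₁ := e₂`, `e(τ) := γ̇⁰(s_τ)` with `s_τ ≥ 0` a crossing parameter of `Σ_τ`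
(`exists_param_of_time`; `s₀ = 0` by strict monotonicity). Given `T ≥ 0`, `μ > 0`, the open
cylinder `𝒩 := {r > r₊ + δ} ∩ {‖y‖ < R}` contains `γ([0, ∞))`, `Σ_{T+1}` is crossed, and
`KerrNullGeodesicGaussianBeams` supplies `𝒩₀ ⊆ 𝒩` and the beam `u`: it vanishes off the
cylinder, `slabSqNorm (□u) T ≤ slabSqNorm (□u) (T + 1) ≤ μ`, `E^N_0(u) = γ̇⁰(0) = e(0)`, and
`|E^N_τ(u) − e(τ)| < μ` for `0 ≤ τ ≤ T` (evaluate at `s = s_τ`). This is Sbierski's use of §7A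
in Thm. 7.4 ("invoking" the symbiosis theorem along `γ_{r₀}`).
[cite: Sbierski2015, Thm. 7.4 with §7A and §4] -/
theorem SbierskiKerrTrappedGeodesicBeams.of_nullGeodesicBeams
    (hγ : Sbierski2015_kerr_trappedNullGeodesic) (hB : KerrNullGeodesicGaussianBeams) :
    SbierskiKerrTrappedGeodesicBeams := by
  intro _ _ M a hM ha₀ haM
  obtain ⟨r₀, e₁, e₂, γ, hr₀, -, he₁, he₁₂, hgeo, hnull, hrad, hγ0, hebd, hcont, hmono, hlim⟩ :=
    hγ M a hM ha₀ haM
  have hrp : 0 < Kerr.rPlus M a := rPlus_pos_of_pos hM a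
  have hr₀pos : 0 < r₀ := hrp.trans hr₀
  -- crossing parameters `s_τ`
  have hcross : ∀ τ : ℝ, 0 ≤ τ → ∃ s, 0 ≤ s ∧ (γ s : E4) 0 = τ := fun τ hτ ↦
    exists_param_of_time γ (fun x : Kerr.exterior M a ↦ (x : E4) 0) hγ0 hcont hlim hτ
  classical
  set sOf : ℝ → ℝ := fun τ ↦ if h : 0 ≤ τ then Classical.choose (hcross τ h) else 0 with hsOf
  have hsOf_spec : ∀ τ : ℝ, 0 ≤ τ → 0 ≤ sOf τ ∧ (γ (sOf τ) : E4) 0 = τ := by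
    intro τ hτ
    simp only [hsOf, dif_pos hτ]
    exact Classical.choose_spec (hcross τ hτ)
  have hsOf0 : sOf 0 = 0 := by
    have h : (γ (sOf 0) : E4) 0 = (γ 0 : E4) 0 := (hsOf_spec 0 le_rfl).2.trans hγ0.symm
    exact hmono.injective h
  -- the energy profile
  set e : ℝ → ℝ := fun τ ↦ E4.time (velocity 𝓘(ℝ, E4) γ (sOf τ)) with he
  refine ⟨r₀ + |a| + 1, fun R hR ↦ ?_⟩
  refine ⟨e, e₁, e₂, (r₀ - Kerr.rPlus M a) / 2, he₁, by linarith, fun τ _ ↦ hebd (sOf τ),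
    fun T hT μ hμ ↦ ?_⟩
  -- the open cylinder containing the orbit
  set δ : ℝ := (r₀ - Kerr.rPlus M a) / 2 with hδ
  set 𝒩 : Set (Kerr.exterior M a) :=
    {x | Kerr.rPlus M a + δ < Kerr.radius a (x : E4) ∧ E4.spatialNorm (x : E4) < R} with h𝒩
  have h𝒩open : IsOpen 𝒩 := by
    have hcr : Continuous fun x : Kerr.exterior M a ↦ Kerr.radius a (x : E4) :=
      (Kerr.continuous_radius a).comp continuous_subtype_val
    have hcs : Continuous fun x : Kerr.exterior M a ↦ E4.spatialNorm (x : E4) := by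
      unfold E4.spatialNorm; fun_prop
    exact (isOpen_lt continuous_const hcr).inter (isOpen_lt hcs continuous_const)
  have hγ𝒩 : γ '' Ici 0 ⊆ 𝒩 := by
    rintro _ ⟨s, -, rfl⟩
    refine ⟨?_, ?_⟩
    · rw [hrad s]; linarith
    · exact (Kerr.spatialNorm_le_of_radius_eq hr₀pos (hrad s)).trans_lt (by linarith)
  -- the beam for `(𝒩, T + 1, μ)`
  obtain ⟨sT, hsT0, hsT⟩ := hcross (T + 1) (by linarith)
  obtain ⟨𝒩₀, -, -, h𝒩₀𝒩, u, hu, hsupp, hbox, hE₀, hEτ⟩ :=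
    hB M a hM ha₀ haM γ hgeo hnull (fun s ↦ he₁.trans_le (hebd s).1) hγ0 hmono 𝒩 h𝒩open hγ𝒩
      (T + 1) (by linarith) ⟨sT, hsT0, hsT⟩ μ hμ
  refine ⟨u, hu, fun x hx ↦ hsupp x fun hx₀ ↦ ?_, (slabSqNorm_mono _ _ (by linarith)).trans hbox,
    ?_, fun τ hτ₀ hτT ↦ ?_⟩
  · -- support: off the cylinder `u` vanishes
    obtain ⟨h1, h2⟩ := h𝒩₀𝒩 hx₀
    rcases hx with hx | hx
    · exact absurd h2 (not_lt.mpr hx)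
    · exact absurd h1 (not_lt.mpr hx.le)
  · -- initial energy `e(0) = γ̇⁰(0)`
    rw [hE₀]
    show _ = ENNReal.ofReal (E4.time (velocity 𝓘(ℝ, E4) γ (sOf 0)))
    rw [hsOf0]
  · -- the energy characterisation at `s = s_τ`
    obtain ⟨hs0, hsτ⟩ := hsOf_spec τ hτ₀
    exact hEτ τ hτ₀ (by linarith) (sOf τ) hs0 hsτ

/-- **The beam input of `TrappingDerivativeLossBeams.lean` from the beams along a given null
geodesic alone**, the trapped null geodesic of §7A being the tree's theorem
`Sbierski2015_kerr_trappedNullGeodesic_holds` (`KerrPhotonOrbit.lean`: the retrograde equatorial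
circular photon orbit). [cite: Sbierski2015, Thm. 7.4 with §7A and §4] -/
theorem SbierskiKerrTrappedGeodesicBeams.of_nullGeodesicBeams'
    (hB : KerrNullGeodesicGaussianBeams) : SbierskiKerrTrappedGeodesicBeams :=
  SbierskiKerrTrappedGeodesicBeams.of_nullGeodesicBeams
    Sbierski2015_kerr_trappedNullGeodesic_holds hB

/-! ### Corollaries: the localised solutions and the barrier from (A) and the beams along a given
geodesic -/

/-- **Sbierski's localised solutions from the Cauchy problem and the beams along a given null
geodesic** (`SbierskiKerrLocalisedSolutions.of_cauchy_of_beams` after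
`SbierskiKerrTrappedGeodesicBeams.of_nullGeodesicBeams'`): the trust base of
`SbierskiKerrLocalisedSolutions` is thereby {(A) `KerrWaveCauchyEnergyEstimate`,
`KerrNullGeodesicGaussianBeams`}. [cite: Sbierski2015, Thm. 5.1 (proof) with §7A and §4] -/
theorem SbierskiKerrLocalisedSolutions.of_cauchy_of_nullGeodesicBeams
    (hA : KerrWaveCauchyEnergyEstimate) (hB : KerrNullGeodesicGaussianBeams) :
    SbierskiKerrLocalisedSolutions :=
  SbierskiKerrLocalisedSolutions.of_cauchy_of_beams hA
    (SbierskiKerrTrappedGeodesicBeams.of_nullGeodesicBeams' hB)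

/-- The data-localised barrier `SbierskiTrappingObstruction` from (A) and the beams along a given
null geodesic. [cite: Sbierski2015, Thm. 5.5 and Thm. 5.1 with §7A] -/
theorem SbierskiTrappingObstruction.of_cauchy_of_nullGeodesicBeams
    (hA : KerrWaveCauchyEnergyEstimate) (hB : KerrNullGeodesicGaussianBeams) :
    SbierskiTrappingObstruction :=
  SbierskiTrappingObstruction.of_cauchy_of_beams hA
    (SbierskiKerrTrappedGeodesicBeams.of_nullGeodesicBeams' hB)

/-- **Sbierski's Kerr trapping theorem (print-literal Thm. 7.4) from (A) and the beams along a
given null geodesic.** [cite: Sbierski2015, Thm. 7.4 via Thm. 5.5, Thm. 5.1, §7A] -/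
theorem SbierskiKerrTrappingLED.of_cauchy_of_nullGeodesicBeams
    (hA : KerrWaveCauchyEnergyEstimate) (hB : KerrNullGeodesicGaussianBeams) :
    SbierskiKerrTrappingLED :=
  SbierskiKerrTrappingLED.of_cauchy_of_beams hA
    (SbierskiKerrTrappedGeodesicBeams.of_nullGeodesicBeams' hB)

end Literature.Barriers.FinalStateConjecture

end
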